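import Literature.Geometry.Lorentzian.LocalTimeSeparation
import HarnessLib

/-!
# The time separation from a point is continuous on a causally convex normal neighbourhood
(Sbierski 2016, §3.2, proof of Thm. 12: *"`τ_q` is … continuous in `V`"*; O'Neill 1983, Lemma 14.21)

Sbierski 2016 (arXiv:1309.7591v3), §3.2, proof of Thm. 12, having written the time separation
from `q` on a causally convex neighbourhood `W` inside a convex neighbourhood `V` as
`τ_q(r) = √(-g|_q(exp_q⁻¹(r), exp_q⁻¹(r)))`: *"In particular `τ_q` is smooth in `I⁻(q) ∩ W` and,
by the global hyperbolicity of `M`, continuous in `V` [Cf. Lemma 21 in Chapter 14 of O'Neill].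
Since `W̄` is compact, `τ_q` takes on its maximum …"*. We prove the continuity needed for the
maximum WITHOUT global hyperbolicity or O'Neill's Lemma 14.21 (continuity of `τ` on globally
hyperbolic sets, via maximal geodesics): on a causally convex open `U` inside the uniformly normal
neighbourhood `W` of `LocalTimeSeparation.lean`, in a causal spacetime, the function
`r ↦ τ(r, q)` (`τ = LorentzianMetric.lorentzDist`, O'Neill Def. 14.15) is continuous on `U`
for every `q ∈ U`:

* `LorentzianMetric.exists_nhds_continuousOn_lorentzDist` — the package of
  `exists_nhds_lorentzDist_eq_radial` (`W`, the two-point inverse `Ξ`, the formula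
  `τ(p, q) = |exp_p⁻¹ q| = |exp_q⁻¹ p|` on causally convex `U ⊆ W`) **together with**
  `ContinuousOn (fun r ↦ τ(r, q)) U` for every open causally convex `U ⊆ W` and `q ∈ U`, provided
  `(M, g, τ)` is causal.

Proof. Put `w(r) = exp_q⁻¹ r` (continuous on `W`) and `Q = g_q(w, w)`, `P = g_q(T_q, w)`. On `U`
one has the bound `τ(r, q) ≤ √(max(0, -Q r))`: for `r < q` this is the local formula, for
`r ∉ J⁻(q)` and `r = q` the left side is `0` (causality). At a point `r₀` with `w(r₀)` past
timelike (`Q < 0 < P`, an open condition) `r` lies in `I⁻(q)` nearby and `τ(·, q) = √(-Q)` is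
continuous; with `w(r₀)` future timelike, `r ∈ I⁺(q)` nearby and `τ(·, q) = 0` (chronology);
otherwise `Q r₀ ≥ 0` (`Q r₀ < 0 = P r₀` being impossible), so `τ(r₀, q) = 0` and the bound tends
to `0`. Everything is proved; no definitions and no named facts are introduced (D-0026).

## References

* J. Sbierski, Ann. Henri Poincaré 17 (2016) 301–329 = arXiv:1309.7591v3, §3.2, proof of Thm. 12
  (arXiv numbering). [Sbierski2016AHP]
* B. O'Neill, *Semi-Riemannian geometry with applications to relativity*, Academic Press 1983,
  Ch. 14, Def. 14.15, Lemma 14.17 and Lemma 14.21 (pp. 409–412); Ch. 5, Prop. 5.34 (p. 147).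
  [ONeillSemiRiemannian1983]
-/

noncomputable section

open Bundle Set Filter Function MeasureTheory
open scoped Manifold ContDiff Topology ENNReal

namespace Literature.Geometry.Lorentzian

open Literature.Geometry.Riemannian

variable {E : Type*} [NormedAddCommGroup E] [NormedSpace ℝ E] {H : Type*} [TopologicalSpace H]
  {I : ModelWithCorners ℝ E H} {M : Type*} [TopologicalSpace M] [ChartedSpace H M]
  [IsManifold I ∞ M]

namespace LorentzianMetric

variable [FiniteDimensional ℝ E] [CompleteSpace E] [T2Space M] [I.Boundaryless]
  {n : ℕ∞ω} {g : LorentzianMetric I n M} [g.HasLeviCivita]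
  [CovariantDerivative.ContMDiffCovariantDerivative g.leviCivita 1] (τ : TimeOrientation g)

/-- **Continuity of the time separation from a point on a causally convex normal neighbourhood**
(Sbierski 2016, §3.2, proof of Thm. 12: *"`τ_q` is … continuous"*; compare O'Neill 1983,
Lemma 14.21). Every point `c` has an open neighbourhood `W` and a two-point inverse `Ξ` of the
exponential map on `W × W` (package of `exists_nhds_lorentzDist_eq_radial`, re-exported together
with the local formula for the time separation on causally convex `U ⊆ W`) such that, **if
`(M, g, τ)` is causal, then for every open causally convex `U ⊆ W` and every `q ∈ U` the function
`r ↦ d(r, q)` is continuous on `U`** (`d` the time separation of `M`, with values in `[0, ∞]`).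
See the module docstring for the proof. [cite: Sbierski2016AHP, §3.2, proof of Thm. 12 (continuity of τ_q)] -/
theorem exists_nhds_continuousOn_lorentzDist (hn : (∞ : ℕ∞ω) ≤ n) (c : M) :
    ∃ (W : Set M) (Ξ : M → M → E), IsOpen W ∧ c ∈ W ∧ W ⊆ (chartAt H c).source ∧
      ContMDiffOn (I.prod I) 𝓘(ℝ, E) ∞ (uncurry Ξ) (W ×ˢ W) ∧
      (∀ p ∈ W, ∀ q ∈ W,
        ((trivializationAt E (TangentSpace I : M → Type _) c).symmL ℝ p (Ξ p q) :
            TangentSpace I p) ∈ expDomain g.leviCivita p ∧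
          expMap g.leviCivita p
            ((trivializationAt E (TangentSpace I : M → Type _) c).symmL ℝ p (Ξ p q)) = q) ∧
      (∀ U : Set M, U ⊆ W →
        (∀ (γ : ℝ → M) (a b : ℝ), a ≤ b → g.IsFutureCausalCurveOn τ γ (Icc a b) →
          γ a ∈ U → γ b ∈ U → MapsTo γ (Icc a b) U) →
        ∀ p ∈ U, ∀ q ∈ U, q ∈ g.causalFuture τ {p} → q ≠ p →
          τ.IsFutureDirected (x := p)
              ((trivializationAt E (TangentSpace I : M → Type _) c).symmL ℝ p (Ξ p q)) ∧
            (g.val q ((trivializationAt E (TangentSpace I : M → Type _) c).symmL ℝ q (Ξ q p))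
                ((trivializationAt E (TangentSpace I : M → Type _) c).symmL ℝ q (Ξ q p)) ≤ 0 ∧
              0 < g.val q (τ.vectorField q)
                ((trivializationAt E (TangentSpace I : M → Type _) c).symmL ℝ q (Ξ q p))) ∧
            g.lorentzDist τ p q = ENNReal.ofReal (Real.sqrt (-g.val p
              ((trivializationAt E (TangentSpace I : M → Type _) c).symmL ℝ p (Ξ p q))
              ((trivializationAt E (TangentSpace I : M → Type _) c).symmL ℝ p (Ξ p q)))) ∧
            g.lorentzDist τ p q = ENNReal.ofReal (Real.sqrt (-g.val q
              ((trivializationAt E (TangentSpace I : M → Type _) c).symmL ℝ q (Ξ q p))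
              ((trivializationAt E (TangentSpace I : M → Type _) c).symmL ℝ q (Ξ q p))))) ∧
      (g.IsCausallyWellBehaved τ → ∀ U : Set M, IsOpen U → U ⊆ W →
        (∀ (γ : ℝ → M) (a b : ℝ), a ≤ b → g.IsFutureCausalCurveOn τ γ (Icc a b) →
          γ a ∈ U → γ b ∈ U → MapsTo γ (Icc a b) U) →
        ∀ q ∈ U, ContinuousOn (fun r ↦ g.lorentzDist τ r q) U) := by
  haveI : Fact (1 ≤ n) := ⟨le_trans (by exact_mod_cast le_top) hn⟩
  obtain ⟨W, Ξ, hWo, hcW, hWsrc, hΞs, hΞ, hform⟩ := exists_nhds_lorentzDist_eq_radial τ hn c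
  set e := trivializationAt E (TangentSpace I : M → Type _) c with he
  refine ⟨W, Ξ, hWo, hcW, hWsrc, hΞs, hΞ, hform, fun hcausal U hUo hUW hUcc q hq ↦ ?_⟩
  have hqW : q ∈ W := hUW hq
  -- chronology and its time reverse
  have hchron : g.IsChronological τ := hcausal.isChronological
  have hchron' : g.IsChronological τ.reverse := hcausal.reverse.isChronological
  have hqq : q ∉ g.chronologicalFuture τ {q} := isChronological_iff.mp hchron q
  have hqq' : q ∉ g.chronologicalPast τ {q} := isChronological_iff.mp hchron' q
  -- the vector `w r = exp_q⁻¹ r` and the scalars `Q`, `P`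
  set w : M → E := fun r ↦ e.symmL ℝ q (Ξ q r) with hw_def
  set Q : M → ℝ := fun r ↦ g.val q (w r) (w r) with hQ_def
  set P : M → ℝ := fun r ↦ g.val q (τ.vectorField q) (w r) with hP_def
  have hwc : ContinuousOn w W := by
    have h1 : ContMDiff I (I.prod I) ∞ (fun r : M ↦ (q, r)) := contMDiff_const.prodMk contMDiff_id
    have h2 : ContMDiffOn I 𝓘(ℝ, E) ∞ (fun r : M ↦ Ξ q r) W :=
      hΞs.comp h1.contMDiffOn fun r hr ↦ ⟨hqW, hr⟩
    exact (e.symmL ℝ q).continuous.comp_continuousOn h2.continuousOn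
  have hQc : ContinuousOn Q W := by
    have hB := (show E →L[ℝ] E →L[ℝ] ℝ from g.val q).continuous₂
    exact hB.comp_continuousOn (hwc.prodMk hwc)
  have hPc : ContinuousOn P W := (g.val q (τ.vectorField q)).continuous.comp_continuousOn hwc
  have hwdom : ∀ r ∈ W, (w r : TangentSpace I q) ∈ expDomain g.leviCivita q := fun r hr ↦
    (hΞ q hqW r hr).1
  have hwexp : ∀ r ∈ W, expMap g.leviCivita q (w r) = r := fun r hr ↦ (hΞ q hqW r hr).2
  -- (K1) the formula below `q`
  have hK1 : ∀ r ∈ U, r ∈ g.causalPast τ {q} → r ≠ q →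
      g.lorentzDist τ r q = ENNReal.ofReal (Real.sqrt (-Q r)) ∧ Q r ≤ 0 ∧ 0 < P r := by
    intro r hr hrq hne
    obtain ⟨-, ⟨hQ, hP⟩, -, hd⟩ := hform U hUW hUcc r hr q hq (mem_causalPast_singleton_iff.1 hrq)
      hne.symm
    exact ⟨hd, hQ, hP⟩
  -- (K2) `τ(r, q) = 0` off `J⁻(q)`
  have hK2 : ∀ r, r ∉ g.causalPast τ {q} → g.lorentzDist τ r q = 0 := fun r hr ↦
    lorentzDist_eq_zero_of_not_mem_causalFuture fun h ↦ hr (mem_causalPast_singleton_iff.2 h)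
  -- (K3) `τ(q, q) = 0`
  have hK3 : g.lorentzDist τ q q = 0 := lorentzDist_self_of_isCausallyWellBehaved hcausal q
  -- (K4) timelike `w r` locates `r` in `I⁻(q)` or `I⁺(q)`
  have hK4 : ∀ r ∈ W, Q r < 0 → (0 < P r → r ∈ g.chronologicalPast τ {q}) ∧
      (P r < 0 → r ∈ g.chronologicalFuture τ {q}) := by
    intro r hr hQ
    refine ⟨fun hP ↦ ?_, fun hP ↦ ?_⟩
    · have hfut : τ.reverse.IsFutureDirected (x := q) (w r) := by
        rw [TimeOrientation.isFutureDirected_reverse_iff]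
        exact ⟨⟨hQ.le, fun h ↦ by simp [hQ_def, h] at hQ⟩, hP⟩
      have h := expMap_mem_chronologicalFuture τ.reverse (hwdom r hr) hQ hfut
      rwa [hwexp r hr] at h
    · have hfut : τ.IsFutureDirected (x := q) (w r) :=
        ⟨⟨hQ.le, fun h ↦ by simp [hQ_def, h] at hQ⟩, hP⟩
      have h := expMap_mem_chronologicalFuture τ (hwdom r hr) hQ hfut
      rwa [hwexp r hr] at h
  -- (K5) points of `I⁺(q)` are not in `J⁻(q)` (chronology)
  have hK5 : ∀ r, r ∈ g.chronologicalFuture τ {q} → r ∉ g.causalPast τ {q} := by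
    intro r hr hrq
    exact hqq (mem_chronologicalFuture_of_mem_chronologicalFuture_of_mem_causalFuture
      (Fact.out : (1 : ℕ∞ω) ≤ n) hr (mem_causalPast_singleton_iff.1 hrq))
  -- (B) the bound `τ(r, q) ≤ √(-Q r)` on `U`, and the value `0` where `Q r ≥ 0`
  have hB : ∀ r ∈ U, g.lorentzDist τ r q ≤ ENNReal.ofReal (Real.sqrt (-Q r)) := by
    intro r hr
    by_cases hrq : r ∈ g.causalPast τ {q}
    · by_cases hne : r = q
      · rw [hne, hK3]; exact bot_le
      · exact (hK1 r hr hrq hne).1.le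
    · rw [hK2 r hrq]; exact bot_le
  have hzero : ∀ r ∈ U, 0 ≤ Q r → g.lorentzDist τ r q = 0 := by
    intro r hr hQ
    by_cases hrq : r ∈ g.causalPast τ {q}
    · by_cases hne : r = q
      · rw [hne, hK3]
      · obtain ⟨hd, hQ', -⟩ := hK1 r hr hrq hne
        rw [hd, show Q r = 0 from le_antisymm hQ' hQ, neg_zero, Real.sqrt_zero, ENNReal.ofReal_zero]
    · exact hK2 r hrq
  -- continuity at each point of `U`
  intro r₀ hr₀
  have hr₀W : r₀ ∈ W := hUW hr₀
  have hUn : U ∈ 𝓝 r₀ := hUo.mem_nhds hr₀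
  by_cases hA : Q r₀ < 0 ∧ 0 < P r₀
  · /- Case A: `r₀ ∈ I⁻(q)`; the formula holds on a neighbourhood -/
    have hO : ∀ᶠ r in 𝓝 r₀, r ∈ U ∧ Q r < 0 ∧ 0 < P r := by
      have h1 : ∀ᶠ r in 𝓝 r₀, Q r < 0 :=
        (hQc.continuousAt (hWo.mem_nhds hr₀W)).eventually (gt_mem_nhds hA.1)
      have h2 : ∀ᶠ r in 𝓝 r₀, 0 < P r :=
        (hPc.continuousAt (hWo.mem_nhds hr₀W)).eventually (lt_mem_nhds hA.2)
      filter_upwards [hUn, h1, h2] with r hr h1 h2 using ⟨hr, h1, h2⟩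
    have heq : (fun r ↦ g.lorentzDist τ r q) =ᶠ[𝓝 r₀] fun r ↦ ENNReal.ofReal (Real.sqrt (-Q r)) := by
      filter_upwards [hO] with r hr
      have hrI : r ∈ g.chronologicalPast τ {q} := (hK4 r (hUW hr.1) hr.2.1).1 hr.2.2
      have hne : r ≠ q := fun h ↦ hqq' (h ▸ hrI)
      exact (hK1 r hr.1 (chronologicalFuture_subset_causalFuture g τ.reverse {q} hrI) hne).1
    have hFc : ContinuousAt (fun r ↦ ENNReal.ofReal (Real.sqrt (-Q r))) r₀ :=
      (ENNReal.continuous_ofReal.comp (Real.continuous_sqrt.comp continuous_neg)).continuousAt.comp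
        (hQc.continuousAt (hWo.mem_nhds hr₀W))
    exact (hFc.congr heq.symm).continuousWithinAt
  · /- Case B: `τ(r₀, q) = 0` and `τ(r, q) → 0` -/
    by_cases hB1 : Q r₀ < 0 ∧ P r₀ < 0
    · -- `r₀ ∈ I⁺(q)`: `τ(·, q) = 0` on a neighbourhood
      have hO : ∀ᶠ r in 𝓝 r₀, r ∈ U ∧ Q r < 0 ∧ P r < 0 := by
        have h1 : ∀ᶠ r in 𝓝 r₀, Q r < 0 :=
          (hQc.continuousAt (hWo.mem_nhds hr₀W)).eventually (gt_mem_nhds hB1.1)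
        have h2 : ∀ᶠ r in 𝓝 r₀, P r < 0 :=
          (hPc.continuousAt (hWo.mem_nhds hr₀W)).eventually (gt_mem_nhds hB1.2)
        filter_upwards [hUn, h1, h2] with r hr h1 h2 using ⟨hr, h1, h2⟩
      have heq : (fun r ↦ g.lorentzDist τ r q) =ᶠ[𝓝 r₀] fun _ ↦ (0 : ℝ≥0∞) := by
        filter_upwards [hO] with r hr
        exact hK2 r (hK5 r ((hK4 r (hUW hr.1) hr.2.1).2 hr.2.2))
      exact ((continuousAt_const).congr heq.symm).continuousWithinAt
    · -- otherwise `Q r₀ ≥ 0`: squeeze with the bound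
      have hQ0 : 0 ≤ Q r₀ := by
        by_contra hQ
        push Not at hQ
        have hP0 : P r₀ = 0 := by
          rcases lt_trichotomy (P r₀) 0 with h | h | h
          · exact absurd ⟨hQ, h⟩ hB1
          · exact h
          · exact absurd ⟨hQ, h⟩ hA
        have hwc' : g.IsCausal (x := q) (w r₀) := ⟨hQ.le, fun h ↦ by simp [hQ_def, h] at hQ⟩
        exact g.val_ne_zero_of_isTimelike_of_isCausal (τ.isTimelike q) hwc' hP0
      have hval : g.lorentzDist τ r₀ q = 0 := hzero r₀ hr₀ hQ0
      have hFc : ContinuousAt (fun r ↦ ENNReal.ofReal (Real.sqrt (-Q r))) r₀ :=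
        (ENNReal.continuous_ofReal.comp (Real.continuous_sqrt.comp continuous_neg)).continuousAt.comp
          (hQc.continuousAt (hWo.mem_nhds hr₀W))
      have hlim0 : Tendsto (fun r ↦ ENNReal.ofReal (Real.sqrt (-Q r))) (𝓝[U] r₀) (𝓝 0) := by
        have h := hFc.tendsto.mono_left (nhdsWithin_le_nhds (s := U))
        have h0 : ENNReal.ofReal (Real.sqrt (-Q r₀)) = 0 := by
          rw [Real.sqrt_eq_zero'.mpr (neg_nonpos.mpr hQ0), ENNReal.ofReal_zero]
        rwa [h0] at h
      show Tendsto (fun r ↦ g.lorentzDist τ r q) (𝓝[U] r₀) (𝓝 (g.lorentzDist τ r₀ q))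
      rw [hval]
      refine tendsto_of_tendsto_of_tendsto_of_le_of_le' tendsto_const_nhds hlim0
        (Eventually.of_forall fun r ↦ bot_le) ?_
      exact eventually_nhdsWithin_of_forall fun r hr ↦ hB r hr

end LorentzianMetric

end Literature.Geometry.Lorentzian

end
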